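import Summits.Ventures.PercRepro.S1JointYSide
import Summits.Ventures.PercRepro.S1JointSplit
import Summits.Ventures.PercRepro.S1CellTableT4

/-!
# PercRepro — S1 CELL TABLE, JOINT FORM: the core cells `21 ≤ p ≤ 24`, `5 ≤ d ≤ 15` at level `4` by kernel evaluation
(p2, gen 15; SUBCLAIM-S1 §5–§6 with LEMMA J)

The cell inequality of `S1CellTable.cellOK` / `S1CellTableT4.cellOK'` with the pairs charged ONCE (Lemma J,
`S1JointPerFlat` / `S1JointSplit` / `S1JointYSide`) and `|S₀| ≤ min(5d, n)`:
`U⁺ = min(7560·C(n, 4) + RS d·Π_all + (RB d − RS d)·Π_{S₀}, 7560·(C(n, 4) + σs(d)·Π_all + (σ(d) − σs(d))·Π_{S₀}))`,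
`R₄ = RS 10·Π_all + (RB 10 − RS 10)·Π_{S₀}`, the rest as before (`s₃ ≤ d(d+1)/2`, `s₄ ≤ min(C(d+3, 4), d(d+1)(d+2)/3)`,
`s₅ ≤ C(d+4, 5)`, `R₃ = 7560·22·(s₃(n − 3) + s₄)`, `Y⁻ = 7560·Σ_{j=5}^{p−1} C(n, j) − R₃ − R₄`, exact `Φ(p, 4)`).

* `cellOK3` — the joint cell inequality as one `Bool` in `ℕ`; `cellOK3_spec` — its meaning with ordinary binomials;
* **`table_21_24`** — the `44` cells `21 ≤ p ≤ 24`, `5 ≤ d ≤ 15` by `decide +kernel` (exact-integer twin: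
  `mining/p2/g15/cellok4.py`; the tightest cell is `(21, 6)` at `Φ·U⁺/Y⁻ = 0.981`);
* **`rls_of_cellOK3`** — a kernel-evaluated joint cell gives `ThmN.RLS M p 4` on the `e`-free core of rank `p` and
  corank `d`.
Axioms: standard.
-/

open scoped Matroid

namespace PercRepro

namespace S1

open Set

variable {α : Type}

/-- **The joint cell inequality at `(p, d)`** as a decidable statement in `ℕ`. -/
def cellOK3 (p d : ℕ) : Bool :=
  let n := p + d
  let m := min (5 * d) n
  let s3 := d * (d + 1) / 2
  let s4 := min (CoreRegimes.chooseF (d + 3) 4) (d * (d + 1) * (d + 2) / 3)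
  let s5 := CoreRegimes.chooseF (d + 4) 5
  let piAll := s3 * CoreRegimes.chooseF n 2 + s4 * n + s5
  let piS0 := s3 * CoreRegimes.chooseF m 2 + s4 * m + s5
  let sigs := ∑ j ∈ Finset.range (d - 5 + 1), Nat.choose 2 j
  let sig := ∑ j ∈ Finset.range (d - 5 + 1), Nat.choose 5 j
  let U := min (7560 * CoreRegimes.chooseF n 4 + RS d * piAll + (RB d - RS d) * piS0)
    (7560 * (CoreRegimes.chooseF n 4 + sigs * piAll + (sig - sigs) * piS0))
  let R3 := 7560 * 22 * (s3 * (n - 3) + s4)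
  let R4 := RS 10 * piAll + (RB 10 - RS 10) * piS0
  let Ysum := 7560 * ∑ j ∈ Finset.Ico 5 p, CoreRegimes.chooseF n j
  let phiNum := 2 ^ (p + 4) - 2 * ∑ u ∈ Finset.range 5, CoreRegimes.chooseF (p + 4) u
  let phiDen := CoreRegimes.chooseF (p + 4) 4
  decide (R3 + R4 ≤ Ysum ∧ phiNum * U + phiDen * (R3 + R4) ≤ phiDen * Ysum)

/-- The two inequalities behind `cellOK3`, with ordinary binomials. -/
theorem cellOK3_spec {p d : ℕ} (h : cellOK3 p d = true) :
    7560 * 22 * (d * (d + 1) / 2 * (p + d - 3) + min ((d + 3).choose 4) (d * (d + 1) * (d + 2) / 3)) +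
        (RS 10 * (d * (d + 1) / 2 * (p + d).choose 2 + min ((d + 3).choose 4) (d * (d + 1) * (d + 2) / 3) * (p + d) + (d + 4).choose 5) +
          (RB 10 - RS 10) * (d * (d + 1) / 2 * (min (5 * d) (p + d)).choose 2 + min ((d + 3).choose 4) (d * (d + 1) * (d + 2) / 3) * min (5 * d) (p + d) + (d + 4).choose 5)) ≤
      7560 * ∑ j ∈ Finset.Ico 5 p, (p + d).choose j ∧
    (2 ^ (p + 4) - 2 * ∑ u ∈ Finset.range 5, (p + 4).choose u) *
        min (7560 * (p + d).choose 4 +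
            RS d * (d * (d + 1) / 2 * (p + d).choose 2 + min ((d + 3).choose 4) (d * (d + 1) * (d + 2) / 3) * (p + d) + (d + 4).choose 5) +
            (RB d - RS d) * (d * (d + 1) / 2 * (min (5 * d) (p + d)).choose 2 + min ((d + 3).choose 4) (d * (d + 1) * (d + 2) / 3) * min (5 * d) (p + d) + (d + 4).choose 5))
          (7560 * ((p + d).choose 4 +
            (∑ j ∈ Finset.range (d - 5 + 1), Nat.choose 2 j) *
              (d * (d + 1) / 2 * (p + d).choose 2 + min ((d + 3).choose 4) (d * (d + 1) * (d + 2) / 3) * (p + d) + (d + 4).choose 5) +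
            ((∑ j ∈ Finset.range (d - 5 + 1), Nat.choose 5 j) - (∑ j ∈ Finset.range (d - 5 + 1), Nat.choose 2 j)) *
              (d * (d + 1) / 2 * (min (5 * d) (p + d)).choose 2 + min ((d + 3).choose 4) (d * (d + 1) * (d + 2) / 3) * min (5 * d) (p + d) + (d + 4).choose 5))) +
      (p + 4).choose 4 *
        (7560 * 22 * (d * (d + 1) / 2 * (p + d - 3) + min ((d + 3).choose 4) (d * (d + 1) * (d + 2) / 3)) +
          (RS 10 * (d * (d + 1) / 2 * (p + d).choose 2 + min ((d + 3).choose 4) (d * (d + 1) * (d + 2) / 3) * (p + d) + (d + 4).choose 5) +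
            (RB 10 - RS 10) * (d * (d + 1) / 2 * (min (5 * d) (p + d)).choose 2 + min ((d + 3).choose 4) (d * (d + 1) * (d + 2) / 3) * min (5 * d) (p + d) + (d + 4).choose 5))) ≤
      (p + 4).choose 4 * (7560 * ∑ j ∈ Finset.Ico 5 p, (p + d).choose j) := by
  unfold cellOK3 at h
  simp only [CoreRegimes.chooseF_eq] at h
  exact of_decide_eq_true h

/-- **THE JOINT TABLE**: every cell `21 ≤ p ≤ 24`, `5 ≤ d ≤ 15` is closed (kernel evaluation of `44` cells). -/
theorem table_21_24' : ∀ p < 25, 21 ≤ p → ∀ d < 16, 5 ≤ d → cellOK3 p d = true := by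
  decide +kernel

/-- The table in the form of the spec. -/
theorem table_21_24 : ∀ p, 21 ≤ p → p ≤ 24 → ∀ d, 5 ≤ d → d ≤ 15 → cellOK3 p d = true :=
  fun p hp hp' d hd hd' => table_21_24' p (by omega) hp d (by omega) hd

/-- **FROM THE JOINT CELL TO `RLS`**: on the `e`-free core of rank `p ≥ 5` and corank `d` (`|E| = p + d`), a
kernel-evaluated cell `cellOK3 p d = true` gives `ThmN.RLS M p 4` (as `rls_of_cellOK'`, with the joint bounds). -/
theorem rls_of_cellOK3 (M : Matroid α) [M.Finite] (p d : ℕ) (hR : M.eRank = (p : ℕ∞))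
    (hn : M.E.ncard = p + d)
    (hfree : ∀ e ∈ M.E, ∃ A ⊆ M.E \ {e}, e ∉ M.closure A ∧ e ∉ M.closure ((M.E \ {e}) \ A))
    (hp : 5 ≤ p) (hok : cellOK3 p d = true) : ThmN.RLS M p 4 := by
  classical
  -- the core facts
  have hL : ∀ e ∈ M.E, ¬ M.IsLoop e := ThmN.not_isLoop_of_free M hfree
  have hs : ∀ e ∈ M.E, ∀ f ∈ M.E, e ≠ f → M.eRk {e, f} = 2 := by
    intro e he f hf hef
    have h2 : (2 : ℕ∞) ≤ M.eRk {e, f} :=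
      ThmN.two_le_eRk_of_two_le_ncard_of_free M hfree (pair_subset he hf) (by rw [ncard_pair hef])
    have h3 : M.eRk {e, f} ≤ 2 := by
      have := M.eRk_le_encard {e, f}
      rwa [encard_pair hef] at this
    exact le_antisymm h3 h2
  have hcirc : ∀ C, M.IsCircuit C → 3 ≤ C.encard := ThmN.three_le_encard_of_circuit M hL hs
  have hline : ∀ L ⊆ M.E, M.eRk L ≤ 2 → L.ncard ≤ 3 := by
    intro L hL' hr
    have := ThmN.ncard_add_one_le_two_pow_of_eRk_le M hL hfree 2 L hL' hr
    omega
  have hplane : ∀ P ⊆ M.E, M.eRk P ≤ 3 → P.ncard ≤ 6 := fun P hP hr =>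
    ThmN.ncard_le_six_of_eRk_le_three_of_free M hfree hP hr
  have hten : ∀ X ⊆ M.E, M.eRk X ≤ 4 → X.ncard ≤ 10 := fun X hX hr =>
    ThmN.ncard_le_ten_of_eRk_le_four_of_free M hfree hX hr
  have hd : M.E.encard = M.eRank + d := by
    rw [hR, ← M.ground_finite.cast_ncard_eq, hn]
    push_cast
    ring
  -- the counts
  set s3 := {C : Set α | M.IsCircuit C ∧ C.ncard = 3}.ncard with hs3
  set s4 := {C : Set α | M.IsCircuit C ∧ C.ncard = 4}.ncard with hs4
  set s5 := {C : Set α | M.IsCircuit C ∧ C.ncard = 5}.ncard with hs5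
  have hb3 : s3 ≤ d * (d + 1) / 2 := by
    have h := two_mul_ncard_triangles_le M (fun L hL hr => hline L hL hr.le) hd
    have h' : 2 * s3 ≤ d * (d + 1) := h
    rw [Nat.le_div_iff_mul_le (by norm_num)]
    omega
  have hb4 : s4 ≤ min ((d + 3).choose 4) (d * (d + 1) * (d + 2) / 3) := by
    refine le_min (ncard_circuits_four_le M hd) ?_
    have h := three_mul_ncard_four_circuits_le M hline hplane hd
    have h' : 3 * s4 ≤ d * (d + 1) * (d + 2) := h
    rw [Nat.le_div_iff_mul_le (by norm_num)]
    omega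
  have hb5 : s5 ≤ (d + 4).choose 5 := ncard_circuits_five_le M hd
  have hU1 := topCount_le_ncard_eRk_eq_four_ncard_le M hR hd
  have hU2 := ncard_eRk_eq_four_ncard_le_le_joint M hcirc hline hplane hten hd
  have hU3 := ncard_eRk_eq_ncard_le_le_split_joint M 4 10 6 (by norm_num) hcirc hten
    (fun X hX hr => hplane X hX (by simpa using hr)) hd
  rw [sum_Icc_three_five (fun k => {C : Set α | M.IsCircuit C ∧ C.ncard = k}.ncard),
    sum_Icc_three_five (fun k => {C : Set α | M.IsCircuit C ∧ C.ncard = k}.ncard)] at hU3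
  have hY := midCount_ge_joint M hcirc hline hplane hten hd p
  rw [hn] at hU2 hU3 hY
  obtain ⟨hcell1, hcell2⟩ := cellOK3_spec hok
  -- the bounds dominate the counts
  set m := min (5 * d) (p + d) with hm
  set piAll := s3 * (p + d).choose 2 + s4 * (p + d) + s5 with hpiAll
  set piS0 := s3 * m.choose 2 + s4 * m + s5 with hpiS0
  set piAllB := d * (d + 1) / 2 * (p + d).choose 2 + min ((d + 3).choose 4) (d * (d + 1) * (d + 2) / 3) * (p + d) + (d + 4).choose 5 with hpiAllB
  set piS0B := d * (d + 1) / 2 * m.choose 2 + min ((d + 3).choose 4) (d * (d + 1) * (d + 2) / 3) * m + (d + 4).choose 5 with hpiS0B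
  have hpiAll_le : piAll ≤ piAllB := by
    rw [hpiAll, hpiAllB]; gcongr
  have hpiS0_le : piS0 ≤ piS0B := by
    rw [hpiS0, hpiS0B]; gcongr
  have hR3_le : 7560 * 22 * (s3 * (p + d - 3) + s4) ≤
      7560 * 22 * (d * (d + 1) / 2 * (p + d - 3) + min ((d + 3).choose 4) (d * (d + 1) * (d + 2) / 3)) := by
    gcongr
  set R34B := 7560 * 22 * (d * (d + 1) / 2 * (p + d - 3) + min ((d + 3).choose 4) (d * (d + 1) * (d + 2) / 3)) +
    (RS 10 * piAllB + (RB 10 - RS 10) * piS0B) with hR34B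
  set sigs := ∑ j ∈ Finset.range (d - 5 + 1), Nat.choose 2 j with hsigs
  set sig := ∑ j ∈ Finset.range (d - 5 + 1), Nat.choose 5 j with hsig
  set UB := min (7560 * (p + d).choose 4 + RS d * piAllB + (RB d - RS d) * piS0B)
    (7560 * ((p + d).choose 4 + sigs * piAllB + (sig - sigs) * piS0B)) with hUB
  set Ysum := 7560 * ∑ j ∈ Finset.Ico 5 p, (p + d).choose j with hYsum
  set phiNum := 2 ^ (p + 4) - 2 * ∑ u ∈ Finset.range 5, (p + 4).choose u with hphiNum
  set phiDen := (p + 4).choose 4 with hphiDen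
  -- `7560·#U ≤ UB` (both counts)
  have hUB : 7560 * Matroid.topCount M p 4 ≤ UB := by
    have hU0 : 7560 * Matroid.topCount M p 4 ≤
        7560 * {B : Set α | B ⊆ M.E ∧ M.eRk B = 4 ∧ B.ncard ≤ d}.ncard := Nat.mul_le_mul_left _ hU1
    refine le_min ?_ ?_
    · calc 7560 * Matroid.topCount M p 4
          ≤ 7560 * {B : Set α | B ⊆ M.E ∧ M.eRk B = 4 ∧ B.ncard ≤ d}.ncard := hU0
        _ ≤ 7560 * (p + d).choose 4 + RS d * piAll + (RB d - RS d) * piS0 := hU2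
        _ ≤ 7560 * (p + d).choose 4 + RS d * piAllB + (RB d - RS d) * piS0B := by gcongr
    · calc 7560 * Matroid.topCount M p 4
          ≤ 7560 * {B : Set α | B ⊆ M.E ∧ M.eRk B = 4 ∧ B.ncard ≤ d}.ncard := hU0
        _ ≤ 7560 * ((p + d).choose 4 + sigs * piAll + (sig - sigs) * piS0) := Nat.mul_le_mul_left _ hU3
        _ ≤ 7560 * ((p + d).choose 4 + sigs * piAllB + (sig - sigs) * piS0B) := by gcongr
  -- `Ysum ≤ 7560·#Y + R34B`
  have hYB : Ysum ≤ 7560 * Matroid.midCount M p 4 + R34B := by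
    calc Ysum ≤ 7560 * Matroid.midCount M p 4 + 7560 * 22 * (s3 * (p + d - 3) + s4) +
          (RS 10 * piAll + (RB 10 - RS 10) * piS0) := hY
      _ ≤ 7560 * Matroid.midCount M p 4 + R34B := by
          rw [hR34B]
          have : RS 10 * piAll + (RB 10 - RS 10) * piS0 ≤ RS 10 * piAllB + (RB 10 - RS 10) * piS0B := by
            gcongr
          omega
  -- the `ℕ` chain: `phiNum · (7560·#U) ≤ phiDen · (7560·#Y)`
  have hchain : phiNum * (7560 * Matroid.topCount M p 4) ≤ phiDen * (7560 * Matroid.midCount M p 4) := by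
    have h1 : phiNum * (7560 * Matroid.topCount M p 4) ≤ phiNum * UB := Nat.mul_le_mul_left _ hUB
    have h2 : phiNum * UB + phiDen * R34B ≤ phiDen * Ysum := hcell2
    have h3 : phiDen * Ysum ≤ phiDen * (7560 * Matroid.midCount M p 4 + R34B) := Nat.mul_le_mul_left _ hYB
    rw [Nat.mul_add] at h3
    omega
  -- cast to `ℚ`
  have hsum : 2 * ∑ u ∈ Finset.range 5, (p + 4).choose u ≤ 2 ^ (p + 4) := by
    have := sum_Ioo_choose_add_four p hp
    omega
  have hphiNumQ : (phiNum : ℚ) = 2 ^ (p + 4) - 2 * ∑ u ∈ Finset.range 5, ((p + 4).choose u : ℚ) := by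
    rw [hphiNum, Nat.cast_sub hsum]
    push_cast
    ring
  have hΦ := phiK_four_mul_choose_eq p hp
  rw [← hphiNumQ] at hΦ
  have hDenPos : (0 : ℚ) < (phiDen : ℚ) := by
    rw [hphiDen]; exact_mod_cast Nat.choose_pos (by omega)
  have hchainQ : (phiNum : ℚ) * (Matroid.topCount M p 4 : ℚ) ≤ (phiDen : ℚ) * (Matroid.midCount M p 4 : ℚ) := by
    have h : ((phiNum * (7560 * Matroid.topCount M p 4) : ℕ) : ℚ) ≤
        ((phiDen * (7560 * Matroid.midCount M p 4) : ℕ) : ℚ) := by exact_mod_cast hchain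
    push_cast at h
    linarith
  rw [ThmN.RLS_iff]
  have hkey : phiK p 4 * (Matroid.topCount M p 4 : ℚ) * (phiDen : ℚ) ≤
      (Matroid.midCount M p 4 : ℚ) * (phiDen : ℚ) := by
    calc phiK p 4 * (Matroid.topCount M p 4 : ℚ) * (phiDen : ℚ)
        = (phiK p 4 * (phiDen : ℚ)) * (Matroid.topCount M p 4 : ℚ) := by ring
      _ = (phiNum : ℚ) * (Matroid.topCount M p 4 : ℚ) := by rw [hphiDen, hΦ]
      _ ≤ (phiDen : ℚ) * (Matroid.midCount M p 4 : ℚ) := hchainQ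
      _ = (Matroid.midCount M p 4 : ℚ) * (phiDen : ℚ) := by ring
  exact le_of_mul_le_mul_right hkey hDenPos

end S1

end PercRepro
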